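import Summits.AtomisticToContinuum.FouriersLaw.Theses.HiddenChargeMazur
import Summits.AtomisticToContinuum.FouriersLaw.Theorems.HiddenChargeMazurThomsonBoundIdentities

/-!
# `HiddenChargeMazur.ThomsonBound` — the static one-sided Thomson form, proved

Closes item `stmt-AtomisticToContinuum-13512`, the support decl `ThomsonBound` of the route
`Summits/AtomisticToContinuum/FouriersLaw/Theses/HiddenChargeMazur` (`thomsonBound_proof`).

For the pinned anharmonic chain `pinnedChain ω₂ lam β γ` (all parameters positive), `T > 0`, any `N`
and `C²` functions `F, G, w_L, w_R` with a common `e^{θH}` bound on values and first partials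
(`θ < 1/(2T)`), the Gibbs state `μ_T = volume.tilted (-H/T) = Z⁻¹ e^{-H/T} dq dp`, the generator
`L = A + γ K` of `OscillatorChain.generator N T T` (`A` Liouville, `K` the two Ornstein–Uhlenbeck
baths) and the total current `J = ∑_i j_i`: if `L F = -J` pointwise and `G` is DRESSED,
`A G = T ∑_b ∂*_{p_b} w_b` with `∂*_p w = -∂_p w + (p/T) w`, then
`γ (∫ J G dμ_T)² ≤ (∫ F J dμ_T) · T ∑_b ∫ (γ ∂_{p_b}G + w_b)² dμ_T`.

Proof (parts A–D of this series make the textbook `L²(μ_T)` computation rigorous on the `e^{θH}`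
class — weighted line-derivative integrations by parts, antisymmetry of `A`, and a cutoff /
dominated-convergence argument for the bath part, whose second derivatives the class does not
control): `∫ F J dμ = γT ∑_b ‖∂_{p_b}F‖²` (`integral_current_mul_self`),
`∫ J G dμ = T ∑_b ⟨∂_{p_b}F, w_b + γ ∂_{p_b}G⟩` (`integral_current_mul_dressed`: Poisson equation,
antisymmetry, dressing identity, adjoint of `∂_p`), then Cauchy–Schwarz for the two-bath form
(`bathSum_cauchySchwarz`); for `N = 0` both sides vanish. Sharp at `G = F_odd`,
`w_b = γ ∂_{p_b} F_even` (not needed).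
[Bonetto–Lebowitz–Rey-Bellet 2000, §4.1; Kundu–Dhar–Narayan 2009, p. 3; Komorowski–Landim–Olla 2012,
Ch. 4]
-/

noncomputable section

open MeasureTheory Filter Topology

namespace Summit.AtomisticToContinuum.FouriersLaw.Theorems

open Literature.MathematicalPhysics.KineticTheory.HeatConduction

namespace ThomsonBound

variable {N : ℕ}

section Pinned

variable {ω₂ lam β : ℝ}

/-! ### `∫ J G ρ = T · SFv` for a dressed `G`, and `∫ J F ρ = γT · SFF` -/

/-- **The current–charge overlap of a dressed test function.** Under the hypotheses of the item
(`L_{T,T} F = -J`, `A G = T ∑_b ∂*_{p_b} w_b` with `∂*_p w = -∂_p w + (p/T) w`), unnormalised: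
`∫ J G ρ = T ∑_b ∫ ∂_{p_b}F (γ ∂_{p_b}G + w_b) ρ`. [folklore] -/
theorem integral_current_mul_dressed (hω : 0 < ω₂) (hl : 0 ≤ lam) (hβ : 0 ≤ β) {γ : ℝ}
    (hγ : 0 < γ) (N : ℕ) {T θ : ℝ} (hT : 0 < T) (hθ : θ < 1 / (2 * T))
    {F G wL wR : PhaseSpace N → ℝ} (hF : ContDiff ℝ 2 F) (hG : ContDiff ℝ 2 G)
    (hwL : ContDiff ℝ 2 wL) (hwR : ContDiff ℝ 2 wR) {C : ℝ}
    (hFle : ∀ x, |F x| ≤ C * Real.exp (θ * (pinnedChain ω₂ lam β γ).hamiltonian N x))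
    (hFq : ∀ x i, |partialQ i F x| ≤ C * Real.exp (θ * (pinnedChain ω₂ lam β γ).hamiltonian N x))
    (hFp : ∀ x i, |partialP i F x| ≤ C * Real.exp (θ * (pinnedChain ω₂ lam β γ).hamiltonian N x))
    (hGle : ∀ x, |G x| ≤ C * Real.exp (θ * (pinnedChain ω₂ lam β γ).hamiltonian N x))
    (hGq : ∀ x i, |partialQ i G x| ≤ C * Real.exp (θ * (pinnedChain ω₂ lam β γ).hamiltonian N x))
    (hGp : ∀ x i, |partialP i G x| ≤ C * Real.exp (θ * (pinnedChain ω₂ lam β γ).hamiltonian N x))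
    (hwLle : ∀ x, |wL x| ≤ C * Real.exp (θ * (pinnedChain ω₂ lam β γ).hamiltonian N x))
    (hwLp : ∀ x i, |partialP i wL x| ≤ C * Real.exp (θ * (pinnedChain ω₂ lam β γ).hamiltonian N x))
    (hwRle : ∀ x, |wR x| ≤ C * Real.exp (θ * (pinnedChain ω₂ lam β γ).hamiltonian N x))
    (hwRp : ∀ x i, |partialP i wR x| ≤ C * Real.exp (θ * (pinnedChain ω₂ lam β γ).hamiltonian N x))
    (hLF : ∀ x, (pinnedChain ω₂ lam β γ).generator N T T F x =
      -(∑ i, (pinnedChain ω₂ lam β γ).bondCurrent N i x))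
    (hD : ∀ z, (∑ x : Fin N, (z.2 x * partialQ x G z -
      partialQ x ((pinnedChain ω₂ lam β γ).hamiltonian N) z * partialP x G z)) =
      T * ∑ i : Fin N, ((if i.val = 0 then -partialP i wL z + z.2 i / T * wL z else 0) +
        (if i.val = N - 1 then -partialP i wR z + z.2 i / T * wR z else 0))) :
    ∫ x, (∑ i, (pinnedChain ω₂ lam β γ).bondCurrent N i x) * G x *
        (pinnedChain ω₂ lam β γ).gibbsDensity N T x =
      T * ∑ i : Fin N,
        ((if i.val = 0 then ∫ x, partialP i F x * (γ * partialP i G x + wL x) *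
            (pinnedChain ω₂ lam β γ).gibbsDensity N T x else 0) +
          (if i.val = N - 1 then ∫ x, partialP i F x * (γ * partialP i G x + wR x) *
            (pinnedChain ω₂ lam β γ).gibbsDensity N T x else 0)) := by
  have h2θ : 2 * θ < 1 / T := by
    have h := (lt_div_iff₀ (by positivity : (0:ℝ) < 2 * T)).mp hθ
    rw [lt_div_iff₀ hT]; linarith
  have hG1 : ContDiff ℝ 1 G := hG.of_le one_le_two
  have hF1 : ContDiff ℝ 1 F := hF.of_le one_le_two
  have hwL1 : ContDiff ℝ 1 wL := hwL.of_le one_le_two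
  have hwR1 : ContDiff ℝ 1 wR := hwR.of_le one_le_two
  -- Step 1: the Poisson equation
  have h1 := integral_current_mul_eq hω hl hβ hγ N hT hθ hF hG1 hFle hFq hFp hGle hGq hGp hLF
  -- Step 2: `∫ F (A G) ρ = T ∑_b ∫ ∂_b F w_b ρ` by the dressing identity and the adjoint of `∂_p`
  have hpi : ∀ (x : PhaseSpace N) (b : Fin N),
      |x.2 b| ≤ 1 * (1 + (pinnedChain ω₂ lam β γ).hamiltonian N x) ^ 1 :=
    fun x b => abs_momentum_le_one_add hl hβ γ N x b hω.le
  have Iadj : ∀ (i : Fin N) {w : PhaseSpace N → ℝ}, ContDiff ℝ 1 w →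
      (∀ x, |w x| ≤ C * Real.exp (θ * (pinnedChain ω₂ lam β γ).hamiltonian N x)) →
      (∀ x, |partialP i w x| ≤ C * Real.exp (θ * (pinnedChain ω₂ lam β γ).hamiltonian N x)) →
      Integrable fun x => F x * (-partialP i w x + x.2 i / T * w x) *
        (pinnedChain ω₂ lam β γ).gibbsDensity N T x := by
    intro i w hw hwle hwp
    have I1 : Integrable fun x => F x * partialP i w x * (pinnedChain ω₂ lam β γ).gibbsDensity N T x :=
      integrable_mul_gibbsDensity_of_le_exp hω hl hβ γ N hT h2θ 0
        (hF.continuous.mul (continuous_partialP hw one_ne_zero i)) fun x =>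
          abs_mul_le_of_le_exp (m := 0) (A := C) (by simpa using hFle x) (hwp x)
    have I2 : Integrable fun x => x.2 i * F x * w x * (pinnedChain ω₂ lam β γ).gibbsDensity N T x :=
      integrable_mul_gibbsDensity_of_le_exp hω hl hβ γ N hT h2θ (1 + 0)
        (((by fun_prop : Continuous fun x : PhaseSpace N => x.2 i).mul hF.continuous).mul
          hw.continuous) fun x =>
          abs_mul_mul_le_of_le_exp (hpi x i) (A := C) (by simpa using hFle x) (hwle x)
    refine ((I2.const_mul T⁻¹).sub I1).congr (Filter.Eventually.of_forall fun x => ?_)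
    simp only [Pi.sub_apply]
    ring
  have Isite : ∀ (i : Fin N) (c : Prop) [Decidable c] {w : PhaseSpace N → ℝ}, ContDiff ℝ 1 w →
      (∀ x, |w x| ≤ C * Real.exp (θ * (pinnedChain ω₂ lam β γ).hamiltonian N x)) →
      (∀ x, |partialP i w x| ≤ C * Real.exp (θ * (pinnedChain ω₂ lam β γ).hamiltonian N x)) →
      Integrable fun x => F x * (if c then -partialP i w x + x.2 i / T * w x else 0) *
        (pinnedChain ω₂ lam β γ).gibbsDensity N T x := by
    intro i c _ w hw hwle hwp
    by_cases hc : c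
    · simp only [hc, if_true]; exact Iadj i hw hwle hwp
    · simp only [hc, if_false, mul_zero, zero_mul]; exact integrable_zero _ _ _
  have Vsite : ∀ (i : Fin N) (c : Prop) [Decidable c] {w : PhaseSpace N → ℝ}, ContDiff ℝ 1 w →
      (∀ x, |w x| ≤ C * Real.exp (θ * (pinnedChain ω₂ lam β γ).hamiltonian N x)) →
      (∀ x, |partialP i w x| ≤ C * Real.exp (θ * (pinnedChain ω₂ lam β γ).hamiltonian N x)) →
      ∫ x, F x * (if c then -partialP i w x + x.2 i / T * w x else 0) *
        (pinnedChain ω₂ lam β γ).gibbsDensity N T x =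
      if c then ∫ x, partialP i F x * w x * (pinnedChain ω₂ lam β γ).gibbsDensity N T x else 0 := by
    intro i c _ w hw hwle hwp
    by_cases hc : c
    · simp only [hc, if_true]
      exact integral_mul_adjointP hω hl hβ γ N hT hθ i hF1 hw hFle (fun x => hFp x i) hwle hwp
    · simp only [hc, if_false, mul_zero, zero_mul, integral_zero]
  have h2 : ∫ x, F x * (∑ i : Fin N, (x.2 i * partialQ i G x -
      partialQ i ((pinnedChain ω₂ lam β γ).hamiltonian N) x * partialP i G x)) *
      (pinnedChain ω₂ lam β γ).gibbsDensity N T x =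
      T * ∑ i : Fin N, ((if i.val = 0 then ∫ x, partialP i F x * wL x *
        (pinnedChain ω₂ lam β γ).gibbsDensity N T x else 0) +
        (if i.val = N - 1 then ∫ x, partialP i F x * wR x *
          (pinnedChain ω₂ lam β γ).gibbsDensity N T x else 0)) := by
    have hsplit : (fun x => F x * (∑ i : Fin N, (x.2 i * partialQ i G x -
        partialQ i ((pinnedChain ω₂ lam β γ).hamiltonian N) x * partialP i G x)) *
        (pinnedChain ω₂ lam β γ).gibbsDensity N T x) = fun x => T * ∑ i : Fin N,
        (F x * (if i.val = 0 then -partialP i wL x + x.2 i / T * wL x else 0) *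
          (pinnedChain ω₂ lam β γ).gibbsDensity N T x +
        F x * (if i.val = N - 1 then -partialP i wR x + x.2 i / T * wR x else 0) *
          (pinnedChain ω₂ lam β γ).gibbsDensity N T x) := by
      funext x
      rw [hD x]
      calc F x * (T * ∑ i : Fin N, ((if i.val = 0 then -partialP i wL x + x.2 i / T * wL x else 0) +
            (if i.val = N - 1 then -partialP i wR x + x.2 i / T * wR x else 0))) *
            (pinnedChain ω₂ lam β γ).gibbsDensity N T x
          = T * ((∑ i : Fin N, ((if i.val = 0 then -partialP i wL x + x.2 i / T * wL x else 0) +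
            (if i.val = N - 1 then -partialP i wR x + x.2 i / T * wR x else 0))) *
            (F x * (pinnedChain ω₂ lam β γ).gibbsDensity N T x)) := by ring
        _ = T * ∑ i : Fin N, ((if i.val = 0 then -partialP i wL x + x.2 i / T * wL x else 0) +
            (if i.val = N - 1 then -partialP i wR x + x.2 i / T * wR x else 0)) *
            (F x * (pinnedChain ω₂ lam β γ).gibbsDensity N T x) := by rw [Finset.sum_mul]
        _ = _ := by
          congr 1
          exact Finset.sum_congr rfl fun i _ => by ring
    have IsiteSum : ∀ i : Fin N, Integrable fun x =>
        F x * (if i.val = 0 then -partialP i wL x + x.2 i / T * wL x else 0) *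
          (pinnedChain ω₂ lam β γ).gibbsDensity N T x +
        F x * (if i.val = N - 1 then -partialP i wR x + x.2 i / T * wR x else 0) *
          (pinnedChain ω₂ lam β γ).gibbsDensity N T x := fun i =>
      (Isite i _ hwL1 hwLle fun x => hwLp x i).add (Isite i _ hwR1 hwRle fun x => hwRp x i)
    rw [hsplit, integral_const_mul, integral_finsetSum _ fun i _ => IsiteSum i]
    congr 1
    refine Finset.sum_congr rfl fun i _ => ?_
    rw [integral_add (Isite i _ hwL1 hwLle fun x => hwLp x i) (Isite i _ hwR1 hwRle fun x => hwRp x i),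
      Vsite i _ hwL1 hwLle fun x => hwLp x i, Vsite i _ hwR1 hwRle fun x => hwRp x i]
  -- Step 3: combine, site by site
  have lin : ∀ (i : Fin N) {w : PhaseSpace N → ℝ}, Continuous w →
      (∀ x, |w x| ≤ C * Real.exp (θ * (pinnedChain ω₂ lam β γ).hamiltonian N x)) →
      ∫ x, partialP i F x * (γ * partialP i G x + w x) * (pinnedChain ω₂ lam β γ).gibbsDensity N T x =
        γ * (∫ x, partialP i F x * partialP i G x * (pinnedChain ω₂ lam β γ).gibbsDensity N T x) +
          ∫ x, partialP i F x * w x * (pinnedChain ω₂ lam β γ).gibbsDensity N T x := by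
    intro i w hw hwle
    have hFic : Continuous (partialP i F) := continuous_partialP hF two_ne_zero i
    have I1 : Integrable fun x => partialP i F x * partialP i G x *
        (pinnedChain ω₂ lam β γ).gibbsDensity N T x :=
      integrable_mul_gibbsDensity_of_le_exp hω hl hβ γ N hT h2θ 0
        (hFic.mul (continuous_partialP hG two_ne_zero i)) fun x =>
          abs_mul_le_of_le_exp (m := 0) (A := C) (by simpa using hFp x i) (hGp x i)
    have I2 : Integrable fun x => partialP i F x * w x * (pinnedChain ω₂ lam β γ).gibbsDensity N T x :=
      integrable_mul_gibbsDensity_of_le_exp hω hl hβ γ N hT h2θ 0 (hFic.mul hw) fun x =>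
          abs_mul_le_of_le_exp (m := 0) (A := C) (by simpa using hFp x i) (hwle x)
    rw [← integral_const_mul, ← integral_add (I1.const_mul γ) I2]
    refine integral_congr_ae (Filter.Eventually.of_forall fun x => ?_)
    simp only
    ring
  rw [h1, h2, Finset.mul_sum, Finset.mul_sum, Finset.mul_sum, ← Finset.sum_add_distrib]
  refine Finset.sum_congr rfl fun i _ => ?_
  rw [lin i hwL.continuous hwLle, lin i hwR.continuous hwRle]
  split_ifs <;> ring

end Pinned

end ThomsonBound

/-! ### The item -/

open Literature.MathematicalPhysics.KineticTheory.HeatConduction ThomsonBound in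
/-- **`HiddenChargeMazur.ThomsonBound` (item stmt-AtomisticToContinuum-13512), proved.** For the
pinned anharmonic chain `pinnedChain ω₂ lam β γ` (all parameters positive), `T > 0`, any `N` and
`C²` functions `F, G, w_L, w_R` with a common `e^{θH}` bound on values and first partials
(`θ < 1/(2T)`): if `L_{T,T} F = -J` pointwise and `G` is dressed,
`{H_N, G} = T ∑_b ∂*_{p_b} w_b` (`∂*_p w = -∂_p w + (p/T) w`), then
`γ (∫ J G dμ_T)² ≤ (∫ F J dμ_T) · T ∑_b ∫ (γ ∂_{p_b}G + w_b)² dμ_T`, `μ_T = Z⁻¹ e^{-H/T} dq dp`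
(`volume.tilted (-H/T)`). Proof: `∫ F J dμ = γT ∑_b ‖∂_b F‖²`
(`integral_current_mul_self`), `∫ J G dμ = T ∑_b ⟨∂_b F, w_b + γ ∂_b G⟩`
(`integral_current_mul_dressed`), Cauchy–Schwarz for the two-bath form
(`bathSum_cauchySchwarz`); `N = 0` reads `0 ≤ 0`.
[Bonetto–Lebowitz–Rey-Bellet 2000, §4.1; Kundu–Dhar–Narayan 2009, p. 3; Komorowski–Landim–Olla
2012, Ch. 4 (variational formulas)] [folklore] -/
theorem thomsonBound_proof :
    Summit.AtomisticToContinuum.FouriersLaw.Theses.HiddenChargeMazur.ThomsonBound := by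
  intro ω₂ lam β γ T hω hl hβ hγ hT P hP N F G wL wR hF hG hwL hwR hgrowth hLF hD
  subst hP
  -- the empty chain
  rcases Nat.eq_zero_or_pos N with hN | hN
  · subst hN
    simp
  obtain ⟨C, θ, hθ, hb⟩ := hgrowth
  have hD' : ∀ z : PhaseSpace N, (∑ x : Fin N, (z.2 x * partialQ x G z -
      partialQ x ((pinnedChain ω₂ lam β γ).hamiltonian N) z * partialP x G z)) =
      T * ∑ i : Fin N, ((if i.val = 0 then -partialP i wL z + z.2 i / T * wL z else 0) +
        (if i.val = N - 1 then -partialP i wR z + z.2 i / T * wR z else 0)) := by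
    intro z
    have h := hD z
    simp only [OscillatorChain.partialP_hamiltonian] at h
    exact h
  -- unpack the growth bounds
  have hB : ∀ (z : PhaseSpace N) (i : Fin N),
      |F z| ≤ C * Real.exp (θ * (pinnedChain ω₂ lam β γ).hamiltonian N z) ∧
      |G z| ≤ C * Real.exp (θ * (pinnedChain ω₂ lam β γ).hamiltonian N z) ∧
      |wL z| ≤ C * Real.exp (θ * (pinnedChain ω₂ lam β γ).hamiltonian N z) ∧
      |wR z| ≤ C * Real.exp (θ * (pinnedChain ω₂ lam β γ).hamiltonian N z) ∧
      |partialP i F z| ≤ C * Real.exp (θ * (pinnedChain ω₂ lam β γ).hamiltonian N z) ∧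
      |partialQ i F z| ≤ C * Real.exp (θ * (pinnedChain ω₂ lam β γ).hamiltonian N z) ∧
      |partialP i G z| ≤ C * Real.exp (θ * (pinnedChain ω₂ lam β γ).hamiltonian N z) ∧
      |partialQ i G z| ≤ C * Real.exp (θ * (pinnedChain ω₂ lam β γ).hamiltonian N z) ∧
      |partialP i wL z| ≤ C * Real.exp (θ * (pinnedChain ω₂ lam β γ).hamiltonian N z) ∧
      |partialQ i wL z| ≤ C * Real.exp (θ * (pinnedChain ω₂ lam β γ).hamiltonian N z) ∧
      |partialP i wR z| ≤ C * Real.exp (θ * (pinnedChain ω₂ lam β γ).hamiltonian N z) ∧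
      |partialQ i wR z| ≤ C * Real.exp (θ * (pinnedChain ω₂ lam β γ).hamiltonian N z) :=
    fun z i => le_of_sum_twelve_le (abs_nonneg _) (abs_nonneg _) (abs_nonneg _) (abs_nonneg _)
      (abs_nonneg _) (abs_nonneg _) (abs_nonneg _) (abs_nonneg _) (abs_nonneg _) (abs_nonneg _)
      (abs_nonneg _) (abs_nonneg _) (hb z i)
  obtain ⟨i₀⟩ : Nonempty (Fin N) := ⟨⟨0, hN⟩⟩
  have hFle := fun z => (hB z i₀).1
  have hGle := fun z => (hB z i₀).2.1
  have hwLle := fun z => (hB z i₀).2.2.1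
  have hwRle := fun z => (hB z i₀).2.2.2.1
  have hFp := fun z i => (hB z i).2.2.2.2.1
  have hFq := fun z i => (hB z i).2.2.2.2.2.1
  have hGp := fun z i => (hB z i).2.2.2.2.2.2.1
  have hGq := fun z i => (hB z i).2.2.2.2.2.2.2.1
  have hwLp := fun z i => (hB z i).2.2.2.2.2.2.2.2.1
  have hwRp := fun z i => (hB z i).2.2.2.2.2.2.2.2.2.2.1
  -- the Gibbs measure and its normalisation
  have hμ : (volume : Measure (PhaseSpace N)).tilted
      (fun x => -(pinnedChain ω₂ lam β γ).hamiltonian N x / T) =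
      (pinnedChain ω₂ lam β γ).gibbsMeasure N T := rfl
  rw [hμ]
  simp only [OscillatorChain.integral_gibbsMeasure]
  set Z : ℝ := ∫ x, (pinnedChain ω₂ lam β γ).gibbsDensity N T x with hZ
  have hZpos : 0 < Z := integral_exp_pos (pinnedChain_integrable_gibbsDensity hω hl.le hβ.le γ N hT)
  -- the two identities and Cauchy–Schwarz
  have hJG := integral_current_mul_dressed hω hl.le hβ.le hγ N hT hθ hF hG hwL hwR hFle hFq hFp hGle
    hGq hGp hwLle hwLp hwRle hwRp hLF hD'
  have hJF := integral_current_mul_self hω hl.le hβ.le hγ N hT hθ hF hFle hFq hFp hLF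
  have hFJ : ∫ x, F x * (∑ i, (pinnedChain ω₂ lam β γ).bondCurrent N i x) *
      (pinnedChain ω₂ lam β γ).gibbsDensity N T x =
      ∫ x, (∑ i, (pinnedChain ω₂ lam β γ).bondCurrent N i x) * F x *
        (pinnedChain ω₂ lam β γ).gibbsDensity N T x :=
    integral_congr_ae (Filter.Eventually.of_forall fun x => by simp only; ring)
  have hCS := bathSum_cauchySchwarz hω hl.le hβ.le γ N hT hθ (a := fun i => partialP i F)
    (vL := fun i x => γ * partialP i G x + wL x) (vR := fun i x => γ * partialP i G x + wR x)
    (C := max C ((|γ| + 1) * C))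
    (fun i => continuous_partialP hF two_ne_zero i)
    (fun i => (continuous_const.mul (continuous_partialP hG two_ne_zero i)).add hwL.continuous)
    (fun i => (continuous_const.mul (continuous_partialP hG two_ne_zero i)).add hwR.continuous)
    (fun i x => (hFp x i).trans (mul_le_mul_of_nonneg_right (le_max_left _ _) (Real.exp_pos _).le))
    (fun i x => ?_) (fun i x => ?_)
  rotate_left
  · refine (abs_add_le _ _).trans ?_
    rw [abs_mul]
    have h1 := hGp x i
    have h2 := hwLle x
    calc |γ| * |partialP i G x| + |wL x|
        ≤ |γ| * (C * Real.exp (θ * (pinnedChain ω₂ lam β γ).hamiltonian N x)) +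
          C * Real.exp (θ * (pinnedChain ω₂ lam β γ).hamiltonian N x) :=
          add_le_add (mul_le_mul_of_nonneg_left h1 (abs_nonneg _)) h2
      _ = (|γ| + 1) * C * Real.exp (θ * (pinnedChain ω₂ lam β γ).hamiltonian N x) := by ring
      _ ≤ max C ((|γ| + 1) * C) * Real.exp (θ * (pinnedChain ω₂ lam β γ).hamiltonian N x) :=
          mul_le_mul_of_nonneg_right (le_max_right _ _) (Real.exp_pos _).le
  · refine (abs_add_le _ _).trans ?_
    rw [abs_mul]
    have h1 := hGp x i
    have h2 := hwRle x
    calc |γ| * |partialP i G x| + |wR x|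
        ≤ |γ| * (C * Real.exp (θ * (pinnedChain ω₂ lam β γ).hamiltonian N x)) +
          C * Real.exp (θ * (pinnedChain ω₂ lam β γ).hamiltonian N x) :=
          add_le_add (mul_le_mul_of_nonneg_left h1 (abs_nonneg _)) h2
      _ = (|γ| + 1) * C * Real.exp (θ * (pinnedChain ω₂ lam β γ).hamiltonian N x) := by ring
      _ ≤ max C ((|γ| + 1) * C) * Real.exp (θ * (pinnedChain ω₂ lam β γ).hamiltonian N x) :=
          mul_le_mul_of_nonneg_right (le_max_right _ _) (Real.exp_pos _).le
  -- pull `Z⁻¹` out of the leak sum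
  have hleak : (∑ i : Fin N, ((if i.val = 0 then Z⁻¹ * ∫ x, (γ * partialP i G x + wL x) ^ 2 *
      (pinnedChain ω₂ lam β γ).gibbsDensity N T x else 0) + (if i.val = N - 1 then
      Z⁻¹ * ∫ x, (γ * partialP i G x + wR x) ^ 2 * (pinnedChain ω₂ lam β γ).gibbsDensity N T x
      else 0))) = Z⁻¹ * ∑ i : Fin N, ((if i.val = 0 then ∫ x, (γ * partialP i G x + wL x) ^ 2 *
      (pinnedChain ω₂ lam β γ).gibbsDensity N T x else 0) + (if i.val = N - 1 then
      ∫ x, (γ * partialP i G x + wR x) ^ 2 * (pinnedChain ω₂ lam β γ).gibbsDensity N T x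
      else 0)) := by
    rw [Finset.mul_sum]
    refine Finset.sum_congr rfl fun i _ => ?_
    split_ifs <;> ring
  rw [hleak, hJG, hFJ, hJF]
  have hZi : 0 ≤ Z⁻¹ := inv_nonneg.2 hZpos.le
  have hfac : 0 ≤ γ * T ^ 2 * Z⁻¹ ^ 2 := by positivity
  nlinarith [mul_le_mul_of_nonneg_left hCS hfac]

end Summit.AtomisticToContinuum.FouriersLaw.Theorems

end
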